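import Summits.ResolutionOfSingularities.ResolutionOfSingularities.Theses.DefectlessFrames
import Summits.ResolutionOfSingularities.ResolutionOfSingularities.Theorems.PureTranscendentalFrames.Negative.LoadBearing

/-!
# Disproof of `PureTranscendentalFrames` (crux stmt-ResolutionOfSingularities-18874, route DefectlessFrames) — work file

Crux (rank 3, "the Lemma case of Zariski's translation loop", dictionary row Z9): `p` prime, `k`
PERFECT of char `p`, `K/k` finitely generated, `O ⊆ K` a valuation ring containing `k`, RANK ONE
(`Nonempty O.valuation.RankOne`) and ZERO-DIMENSIONAL (every `x ∈ O` has a nonzero `f ∈ k[X]` with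
`f(x) ∈ 𝔪_O`). For every frame `x : Fin (n+1) → O` of algebraically independent elements and every
`g ≠ 0` in `k[X₀..Xₙ]` there are a frame `x' : Fin (n+1) → O` (algebraically independent) and `G`
with: `k[x] ⊆ k[x']` (domination), `G(x') = g(x)` (transport; `G` is then unique), GENERAL POSITION
`axis n x' G = G(x̄'₀,…,x̄'ₙ₋₁, X) ≠ 0` in `κ(O)[X]`, AXIS ORDER `mult_{x̄'ₙ} axis(x',G) ≤ mult_{x̄ₙ}
axis(x,g)` whenever `axis(x,g) ≠ 0`, and PURITY of `w = x'ₙ` over `K₁ = k(x'₀,…,x'ₙ₋₁)`: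
(P1) some `h ∈ K₁` attains the distance, `v(w − h) ≤ v(w − a)` for all `a ∈ K₁` (multiplicative
`v`: `h` is a best approximation), OR (P2) for every nonzero `q ∈ K₁[X]` some `a ∈ K₁` has
`v(q(w) − q(a)) < v(q(w))`.

## Findings of cdisprove cycle 1 (2026-08-17). Kernel-checked unless marked COMMENT.

**No kill.** The crux elaborates (probe rc 0), has no junk corner that bites (read-back below), is
TRUE for `n = 0` and — by a valuation-theoretic argument recorded as COMMENT — carries no purity
content for `n = 1` either; its open content starts at `n ≥ 2` (transcendence degree ≥ 3), exactly
at frames all of whose admissible co-frame fields `K₁` have a henselization that is NOT algebraically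
maximal. What this file proves:

* §0 `pureTranscendentalFrames_iff` — the crux restated verbatim (`Iff.rfl`), so the variants below
  are visibly one-token edits of it.
* §1 MODEL (any field `k`): the `X`-adic place of `k(X)` — `X_mem_OX`, `const_mem_OX`,
  `v_const_eq_one`, `isEquiv_OX`, `rankOne_OX` (rank one), `exists_const_OX` (residually rational:
  every `x ∈ O` is `≡` a constant), `zeroDim_OX`, `fg_top`, `algInd_X`. Reusable; all hypotheses of
  the crux are met by `(𝔽₂, 𝔽₂(X), O_X)`, so the crux is NOT vacuous (frames exist for `n = 0`).
* §2 (a) LOAD-BEARING FRAME HYPOTHESES (landed as `Theorems/PureTranscendentalFrames/Negative/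
  LoadBearing.lean`, proposal p150697):
  - `pureTranscendentalFrames_false_without_g_ne_zero`: drop `g ≠ 0` ⇒ FALSE (`n = 0`, `x = (X)`,
    `g = 0`: `G(x') = 0` forces `G = 0` by algebraic independence of `x'`, so `axis 0 x' G = 0`).
  - `pureTranscendentalFrames_false_without_algIndep`: drop `AlgebraicIndependent k x` ⇒ FALSE
    (`x = (0)`, `g = X₀`: `G(x') = g(0) = 0` again).
  - COMMENT (paper, cheap): NO ambient hypothesis (`p.Prime`, `CharP`, `PerfectField`, `FG`,
    `RankOne`, zero-dimensionality) can be shown load-bearing by an `n = 0` or `n = 1` witness,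
    because the crux is TRUE there for every field and every valuation ring (see "Why it resists"
    1–2); a witness for any of them needs `n ≥ 2` and a defect configuration (ibid. 3).
* §3 (c) NATURAL STRENGTHENINGS.
  - `not_pureTranscendentalFramesTranscendentalTypeOnly` (landed in the same Negative file): deleting
    (P1) — purity := (P2) alone — is FALSE: at the residually rational place `O_X` of `𝔽₂(X)`,
    `n = 0`, for EVERY frame `x' = (w)`: `K₁ = k`, `w ≡ c ∈ k (mod 𝔪)`, and `q = X − c` has
    `q(w) − q(a) = w − a` of value `v(w − c) = v(q(w))` (`a = c`) or `1 > v(q(w))` (`a ≠ c`). So (P1) is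
    load-bearing already over `K₁ = k`. (Informally: (P2) is Kaplansky's TRANSCENDENTAL approximation
    type; a residually rational `w` over a field with the trivial/degenerate distance set is of
    "attained" type, never of transcendental type.)
  - `PureTranscendentalFramesAttainedOnly` (deleting (P2)) is DEFINED but NOT refuted: it is TRUE at
    `n = 0` (COMMENT below), and at `n = 1` a witness would need a frame ALL of whose dominating
    frames have `x'₁` in the closure of `k(x'₀)` inside `K̂` — the prover defeats this by moving the
    uniformising direction into the last slot (e.g. over `K ⊂ k((t))`: `x' = (σ − σ₁t, t)` has
    `v(k(x'₀)^×) = 2ℤ`, so `t ∉ closure`, distance attained). No witness found; probably needs `n ≥ 2`.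
  - `not_pureTranscendentalFramesNoReframing` (landed in `Negative/GeneralPosition.lean`): the
    strengthening "`x' := x`, `G := g`" (no re-framing) is FALSE as soon as a frame is not in
    general position: `n = 1`, `K = 𝔽₂(z₁, z₂) ⊆ 𝔽₂((X))` (`z₁, z₂` algebraically independent
    Laurent series of positive value, by a cardinality count), `x = (z₁, z₂)`, `g = X₀`:
    `axis 1 x g = C(z̄₁) = 0` — the FIRST two-element frames in Lean (non-vacuity at `n = 1`).
  - `not_pureTranscendentalFramesUnguardedAxis` (same file): the UNGUARDED axis clause (drop the
    guard `axis n x g ≠ 0 →`; Mathlib's `rootMultiplicity _ 0 = 0`) is FALSE at the same frame: it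
    would force `G(x')` to be a unit, but `G(x') = g(x) = z₁ ∈ 𝔪` and the axis polynomial at `x̄'₁`
    is the residue of `G(x')` (`Negative.eval_residue_axis`, reusable). So the guard is right.

## Read-back of the elaborated statement (no junk found)

* `O.valuation` is Mathlib's multiplicative valuation: `v ≤ 1` on `O`, `O.nonunits = {v < 1} = 𝔪_O`;
  "attains the distance" = `v(w − h)` is the MINIMUM of `v(w − a)` — correctly oriented; (P2) is the
  multiplicative form of "`v(q(w) − q(a)) > v(q(w))` additively" — correctly oriented.
* `ρ : k → κ(O)` is a ring map out of a field, injective; `axis m w g = g(w̄₀,…,w̄ₘ₋₁, X) ∈ κ(O)[X]`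
  (coefficients through `ρ`, last variable kept); for `m = 0` it is `g` itself mapped by `ρ`, hence
  `≠ 0` iff `g ≠ 0`.
* `rootMultiplicity` of the zero polynomial is `0` in Mathlib, but the clause is GUARDED by
  `axis n x g ≠ 0 →` and `axis n x' G ≠ 0` is demanded, so no junk value is ever compared.
* `G` is uniquely determined (`x'` algebraically independent and `g(x) ∈ k[x] ⊆ k[x']`), so
  "`∃ G`" is harmless; `K₁ : IntermediateField k K`, `q : (↥K₁)[X]`, `a : ↥K₁` — fine.
* Quantifier order matches the informal text; `hk` is used (in `ρ`), so it cannot be dropped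
  syntactically; `trdeg K` is NOT tied to `n + 1` (frames of any length `≤ trdeg K` are allowed) —
  intended (Zariski's Lemma is applied to sub-frames), and harmless: everything happens inside the
  algebraic closure `L` of `k(x)` in `K`, a finitely generated field of trdeg `n + 1` with the
  restricted (rank-one, zero-dimensional) valuation.

## Why it resists (COMMENT — the analysis the provers should read)

Notation: `L ⊆ K` the algebraic closure of `k(x)` in `K` (every dominating frame lives in `O ∩ L`),
`v` rank one, `κ(L)/k` finite. For a subfield `K₁ ⊆ L` write `K₁ʰ ⊆ K̂₁ ⊆ L̂` (rank one: the
henselization sits in the completion).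

1. `n = 0` IS TRUE for every field `k` and every valuation ring `O ∋ k` (no rank / dimension /
   perfectness needed): take `x' = x`, `G = g`; `axis 0 x g = ρ(g) ≠ 0`; the multiplicity clause is
   `le_rfl`; purity over `K₁ = k`: if some constant `c` has `v(w − c) < 1` then `h = c` attains
   (every other constant gives value `1`), otherwise all `v(w − a) = 1` and `h = 0` attains. So every
   `_false_without_` witness for an AMBIENT hypothesis needs `n ≥ 1`.
2. PURITY IS AUTOMATIC WHENEVER `K₁ʰ` IS ALGEBRAICALLY MAXIMAL — in particular for `n = 1` ALWAYS.
   Proof sketch (Kaplansky 1942 Thms 2–3; Kuhlmann 2010 §2): let `w ∈ O` be transcendental over `K₁`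
   with (P1) failing. Then `{v(w − a) : a ∈ K₁}` has no minimum, and a sequence `a_ν ∈ K₁` with
   `v(w − a_ν)` strictly decreasing and coinitial is pseudo-Cauchy with pseudo-limit `w` and NO
   pseudo-limit in `K₁` (a pseudo-limit `b ∈ K₁` would attain the distance). (i) If it is of
   transcendental type (`v(q(a_ν))` eventually constant for every `q`), the three-term argument
   `q(w) = q(a_ν) + (q(w) − q(a_ν))` with `v(q(w) − q(a_ν))` eventually strictly decreasing (Taylor
   expansion, Kaplansky's Lemma 8) gives `v(q(w) − q(a_ν)) < v(q(w))` eventually: (P2) holds with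
   `a = a_ν`. (ii) If it is of algebraic type, Kaplansky's Thm 3 gives an IMMEDIATE algebraic
   extension `K₁(θ)`, `θ` a pseudo-limit; then `K₁ʰ(θ)/K₁ʰ` is immediate, and proper — `θ ∈ K₁ʰ ⊆ K̂₁`
   would make `θ` a Cauchy limit from `K₁`, giving either an element of `K₁` closer to `θ` than every
   `a_ν` (a pseudo-limit in `K₁`, excluded) or breadth `0`, whence `a_ν → w` in `L̂` and `w = θ`
   algebraic (excluded). So `K₁ʰ` is not algebraically maximal. CONSEQUENCES: purity of EVERY
   transcendental `w ∈ O` over `K₁` holds when (a) `v|K₁` is DISCRETE of rank one — directly: a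
   pseudo-Cauchy sequence with values in a discrete group is Cauchy, so its pseudo-limit in `L̂` is
   unique, a transcendental pseudo-limit `w` is THE limit, `q(a_ν) → q(w) ≠ 0`, and (P2) holds (no
   appeal to `K₁ʰ`: for `trdeg K₁ ≥ 2` a discrete `K₁` is non-Abhyankar, `O_{K₁}` is a non-excellent
   DVR and `K₁ʰ ⊊ K̂₁` does carry F. K. Schmidt's inseparable defect, cf. `ValuationDefectExample` —
   harmless here); this is ALWAYS the case for `n = 1`, every valuation of `k(x'₀)` trivial on `k`
   being discrete or trivial, and non-trivial by zero-dimensionality (`f(x'₀) ∈ 𝔪 ∖ 0`);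
   (b) `(K₁, v)` has no transcendence defect over `k`
   (`rr v(K₁) + trdeg κ(K₁) = trdeg K₁`, "Abhyankar"): generalized stability (Kuhlmann 2010 Thm 1.1,
   in tree: `Kuhlmann2010Stability_holds`, PROVED) makes it a defectless field; in particular
   whenever `L` itself is Abhyankar (then every co-frame field `K₁` has `rr = n`); (c) `v` discrete on
   `L`. Together with 1 and the general-position move of 4, the crux is TRUE for `n ≤ 1`, for
   Abhyankar places in every dimension, and for discrete zero-dimensional places in every dimension
   — i.e. everywhere local uniformization is classically easy. The item's docstring ("from trdeg 2
   on") is off by one: the typed kangaroo phenomenon needs `trdeg K₁ ≥ 2`, i.e. `n ≥ 2`, trdeg `L ≥ 3`.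
3. WHERE A KILL MUST LIVE — and the prover's three escapes. A counterexample is a rank-one
   zero-dimensional `(L, v)` of trdeg `n + 1 ≥ 3` over a perfect `k` WITH transcendence defect ≥ 2
   (for `trdef L = 0` EVERY co-frame field is Abhyankar and 2(b) settles the crux on paper; for
   `trdef L = 1` the prover needs a dominating frame whose co-frame field keeps the full rational
   rank `n` — expected from Perron transforms (Zariski 1940 B.I Thm 2: after `x = y^A`, `A`
   unimodular, `v(y₁),…,v(y_r)` are rationally independent and the other `y_j` are units) followed
   by putting a unit last, but the preliminary step "make the frame's values span `ℚ ⊗ v(L)`" is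
   itself a translation loop and was NOT checked; so take `trdef L ≥ 2` as the safe regime),
   WLOG `κ(L) = k`, `v(L) ⊆ ℚ` of rational rank 1, e.g. `v(L) = ℤ[1/p]`, and a frame `x`
   such that for EVERY dominating frame `x'` (including PERMUTED frames and all Perron /
   Frobenius–Nagata re-embeddings `k[x] ⊆ k[x']`) the co-frame field `K₁ = k(x'_{<n})` defeats:
   (E1) DISCRETENESS — if `v|K₁` is discrete, 2(a) makes `x'ₙ` pure; so `L` must contain no
   discretely valued co-frame subfield (generic Hahn-series embeddings `L ⊂ k((t^{ℤ[1/p]}))` with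
   unbounded denominators in every generator beyond the first achieve this: `L ∩ k((t^{1/N}))^{alg}
   = k(t)`); (E2) INDEX — with `κ = k`, (P1) is attained iff some `v(w − h) ∉ v(K₁)`; the subgroups of
   finite index of `ℤ[1/p]` are `d·ℤ[1/p]`, `p ∤ d`, so (P1) fails for every `w` exactly when
   `v(K₁) = v(L)`; the refuter must force index 1 for every co-frame field (e.g. `p = 3`,
   `b = Σ t^{1−1/3ⁱ}` has all exponents in `2ℤ[1/3]`, and `K₁ = k(b, c)` of index 2 lets the prover
   put `t` LAST and win by (P1) at `h = 0` — generic tails with exponents in every coset are needed);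
   (E3) TRANSCENDENTAL TYPE — once (P1) fails, `K₁(w)|K₁` is immediate and (P2) fails iff `w` is a
   pseudo-limit of an ALGEBRAIC-type sequence of `K₁`, i.e. `w = θ + u` with `θ` a defect root over
   `K₁ʰ` (dependent Artin–Schreier defect; Kuhlmann, Trans. AMS 356 (2004) 4559–4600 §§3–4, and
   *A classification of Artin–Schreier defect extensions*, 2010) and `v(u)` beyond the breadth:
   indeed for `θ^p − θ = c ∈ K₁`, `q = X^p − X − c`: `q(w) − q(a) = ℘(w − a)` has value `v(w − a)`,
   always short of `v(q(w)) = v(u)` — so such `w` ARE impure (paper-checked example of impurity;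
   it also shows impurity is compatible with `w` raising the rational rank, so "value-transcendental
   ⇒ pure" is FALSE without attainment). The cheapest candidate is therefore `n = 2`, `g = 1`, and — located late in this
   session — it can be made EXPLICIT from print: Cutkosky–Piltant, *Ramification of valuations*,
   Adv. Math. 183 (2004) 1–79 (re-analysed in Cutkosky–Mourtada–Teissier(?), arXiv:1904.10702 §9,
   "A rank 1 separable example with defect", held: `paper:arxiv-1904.10702` p. 25) give, over
   `k = k̄` of char `p`, the zero-dimensional rank-one valuation `ν` on `K₁ = k(u, v)` with generating
   sequence `P₀ = u, P₁ = v, P₂ = v^{p²} − u, P_{i+1} = P_i^{p²} − u^{p^{2i−2}} P_{i−1}`, `ν(u) = 1`,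
   value group `(1/p^∞)ℤ` (so `trdef K₁ = 1`, non-discrete, index-1-friendly), and PROVE that
   `f = x^p + u x^{p−1} − u` defines an IMMEDIATE (defect `p`, unique) extension `K₁(θ)`. Put
   `L = k(u, v, w)`, `w = θ + t` with `t` a new transcendental of huge value `ν(t) = N` (restrict the
   valuation of `K₁(θ)(t)`): over the co-frame field `K₁` the last element `w` is IMPURE by (E3)
   (`ν(f(w) − f(a))` stays below `p·dist(θ, K₁) + O(1)` while `ν(f(w)) ≈ N + ν(f′(θ))` is as large
   as we like) — a paper-level impure frame `x = (u, v, w)` at `n = 2`, the first concrete one. What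
   is NOT decided is the prover's re-framing: e.g. the permuted frame `(u, w; v)` has co-frame field
   `k(u, w) ≈ k(u, θ)(t)` with `v(k(u,θ)) = (1/p)ℤ ∌ ν(v) = 1/p²`, so unless `N` is chosen with
   denominator `p²` (and matching residues) the prover wins by (E2)/(P1) at `h = 0`; each such
   repair by the refuter opens the next re-framing (Perron transforms of `(u, v, w)`, twists), and
   deciding the game is a MacLane–Vaquié key-polynomial computation per re-framing class — the
   generating-sequence technology of arXiv:1904.10702 §§3–4 is exactly the engine a `kit` job would
   have to implement. Recorded for cycle 2 / a compute seat. A kill through a frame in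
   general position with small axis order `s` restricts the prover more than `g = 1` (permutations
   stop being free: the axis lives in the last variable), so `s = 1` frames on the same `L` are the
   second candidate.
4. GENERAL POSITION AND AXIS ORDER ARE FREE (so they cannot be the source of a kill): the
   Frobenius–Nagata twist `x'ᵢ = xᵢ + xₙ^{p^{eᵢ}}` (`i < n`), `x'ₙ = xₙ`, `e₀ ≫ e₁ ≫ … ≫ 0`, keeps
   `x' ⊆ O`, algebraic independence and `k[x'] = k[x]`, transports `g` to `G = g(X'ᵢ − X'ₙ^{p^{eᵢ}},
   X'ₙ)`, makes `axis n x' G ≠ 0` (a unique top `X`-monomial), and — because `(x̄ₙ + Y)^{p^e} =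
   x̄ₙ^{p^e} + Y^{p^e}` in characteristic `p` — does not raise the axis order when `axis n x g ≠ 0`
   (the `Y^s` coefficient of the old axis survives untouched once all `p^{eᵢ} > s`). It does change
   `K₁`, which is the prover's main lever on purity.
5. NEAREST FACTS IN TREE for a prover: `ImmediateRationalUniformization.lean` (Kaplansky
   approximation, KK2009 Lemmas 2.5/2.18 PROVED: `exists_valuation_sub_lt` is exactly "immediate ⇒
   (P1) fails"), `TranscendentallyImmediate.lean`, `HenselizationDefectless.lean`,
   `GeneralizedStability*` / `Kuhlmann2010Stability_holds` (case (b) of 2), `Kuhlmann2019HenselianRationality*`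
   (immediate trdeg-1 function fields over tame fields lie in some `K(x)ʰ` — the positive theory
   closest to (P2)), `ValuationDefectExample.lean` (F. K. Schmidt defect inside `𝔽_p((X))`: a
   DISCRETE place, so by 2(a)/(c) useless for impurity but the right ambient for the `n = 1`
   general-position witnesses of §3).

## Attacks run this cycle (for the census)
probe elaboration; symbol-by-symbol read-back; degenerate corners `n = 0` (true), `g = 1` (reduces
to pure-frame existence), `g = 0` / `x` dependent (refuted variants, landed), `K₁ = k` purity
(strengthening (P2)-only refuted, landed); hypothesis drops `RankOne` / zero-dim / `PerfectField` /
`FG` / `CharP` at `n ≤ 1` (all survive: crux true there); paper analysis of `n = 1` (purity automatic)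
and of Abhyankar / discrete places (automatic); literature: Cutkosky–Mourtada 2019 pp. 3–4 read
(statements (1)/(2); the crux is the typed "almost" of (1)), arXiv:1904.10702 §9 p. 25 read (the
Cutkosky–Piltant 2004 rank-1 defect example on `k(u,v)` — basis of the explicit `n = 2` candidate in
3), Kuhlmann's *Approximation types describing extensions of valuations to rational function fields*
(galaxy hit, not opened), Kaplansky 1942 / Kuhlmann 2004, 2010 (from memory + tree files; the local
`lit search` daemon was down all session, OpenAlex over quota); barrier catalogue: `KangarooShadeIncrease*`, `LocalMonomializationFails*`,
`ArtinSchreierPuiseux` concern residual-order / monomialization invariants, not frame purity — none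
bites directly; `ledger negatives` unavailable (gate down) — the route file reports 0 prior refuted
statements besides the misstated `DefectlessFrames`.
-/

set_option linter.dupNamespace false

open scoped Polynomial
open IsDedekindDomain.HeightOneSpectrum

namespace Summit.ResolutionOfSingularities.ResolutionOfSingularities.Cruxes.PureTranscendentalFrames.Disproof

noncomputable section

/-! ## §1 The models (landed, imported)

* `Theorems/PureTranscendentalFrames/Negative/LoadBearing.lean` (p150697): the `X`-adic place of
  `k(X)`, any field `k` — `X_mem_OX`, `const_mem_OX`, `v_const_eq_one`, `isEquiv_OX`, `rankOne_OX`,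
  `exists_const_OX`, `zeroDim_OX`, `fg_top`, `algInd_X` (frames of length 1).
* `Theorems/PureTranscendentalFrames/Negative/GeneralPosition.lean` (p151611; not imported in this
  revision, see §3): `𝔽_p(z₁, z₂) ⊆ 𝔽_p((X))` with the `X`-adic place — `exists_frame_laurentSeries`, `fg_top_adjoin`,
  `const_mem_comap`, `isEquiv_comap`, `rankOne_comap`, `zeroDim_comap`, `axis_X_zero_eq_zero`
  (frames of length 2, the first element in `𝔪`), and the bookkeeping lemmas `eval_residue_axis`,
  `coe_eval₂_codRestrict` (axis polynomial at the last residue = residue of `G(x')`).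
-/

/-! ## §0 The crux, verbatim (so that the variants below are visibly one-token edits of it) -/

/-- The crux `PureTranscendentalFrames`, restated verbatim. [folklore] -/
theorem pureTranscendentalFrames_iff :
    Summit.ResolutionOfSingularities.ResolutionOfSingularities.Theses.DefectlessFrames.PureTranscendentalFrames ↔
    (∀ p : ℕ, p.Prime → ∀ (k K : Type) [Field k] [CharP k p] [PerfectField k] [Field K] [Algebra k K], (⊤ : IntermediateField k K).FG → ∀ O : ValuationSubring K, ∀ hk : (∀ c : k, algebraMap k K c ∈ O), Nonempty O.valuation.RankOne → (∀ x ∈ O, ∃ f : Polynomial k, f ≠ 0 ∧ Polynomial.aeval x f ∈ O.nonunits) → let ρ : k →+* IsLocalRing.ResidueField O := (IsLocalRing.residue O).comp ((algebraMap k K).codRestrict O hk); let axis : (m : ℕ) → (Fin (m + 1) → O) → MvPolynomial (Fin (m + 1)) k → Polynomial (IsLocalRing.ResidueField O) := fun _ w g => MvPolynomial.eval₂ (Polynomial.C.comp ρ) (Fin.snoc (fun j => Polynomial.C (IsLocalRing.residue O (w (Fin.castSucc j)))) Polynomial.X) g; ∀ (n : ℕ) (x : Fin (n + 1) → O) (g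 : MvPolynomial (Fin (n + 1)) k), AlgebraicIndependent k (fun i => (x i : K)) → g ≠ 0 → ∃ (x' : Fin (n + 1) → O) (G : MvPolynomial (Fin (n + 1)) k), AlgebraicIndependent k (fun i => (x' i : K)) ∧ (∀ i, (x i : K) ∈ Algebra.adjoin k (Set.range fun i => (x' i : K))) ∧ MvPolynomial.aeval (fun i => (x' i : K)) G = MvPolynomial.aeval (fun i => (x i : K)) g ∧ axis n x' G ≠ 0 ∧ (axis n x g ≠ 0 → (axis n x' G).rootMultiplicity (IsLocalRing.residue O (x' (Fin.last n))) ≤ (axis n x g).rootMultiplicity (IsLocalRing.residue O (x (Fin.last n)))) ∧ let K₁ : IntermediateField k K := IntermediateField.adjoin k (Set.range fun j : Fin n => (x' (Fin.castSucc j) : K)); let w : K := (x' (Fin.last n) : K); ((∃ h ∈ K₁, ∀ a ∈ K₁, O.valuation (w - h) ≤ O.valuation (w - a)) ∨ (∀ q : Polynomial K₁, q ≠ 0 → ∃ a : K₁, O.valuation (Polynomial.aeval w q - algebraMap K₁ K (Polynomial.eval a q)) < O.valuation (Polynomial.aeval w q)))) :=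
  Iff.rfl

/-! ## §2 (a) Load-bearing hypotheses of the frame -/

/-- The crux with the frame hypothesis `g ≠ 0` DROPPED. -/
def PureTranscendentalFramesWithoutGNeZero : Prop :=
  ∀ p : ℕ, p.Prime → ∀ (k K : Type) [Field k] [CharP k p] [PerfectField k] [Field K] [Algebra k K], (⊤ : IntermediateField k K).FG → ∀ O : ValuationSubring K, ∀ hk : (∀ c : k, algebraMap k K c ∈ O), Nonempty O.valuation.RankOne → (∀ x ∈ O, ∃ f : Polynomial k, f ≠ 0 ∧ Polynomial.aeval x f ∈ O.nonunits) → let ρ : k →+* IsLocalRing.ResidueField O := (IsLocalRing.residue O).comp ((algebraMap k K).codRestrict O hk); let axis : (m : ℕ) → (Fin (m + 1) → O) → MvPolynomial (Fin (m + 1)) k → Polynomial (IsLocalRing.ResidueField O) := fun _ w g => MvPolynomial.eval₂ (Polynomial.C.comp ρ) (Fin.snoc (fun j => Polynomial.C (IsLocalRing.residue O (w (Fin.castSucc j)))) Polynomial.X) g; ∀ (n : ℕ) (x : Fin (n + 1) → O) (g : MvPolynomial (Fin (n + 1)) k), AlgebraicIndependent k (fun i => (x i : K)) → ∃ (x' :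 Fin (n + 1) → O) (G : MvPolynomial (Fin (n + 1)) k), AlgebraicIndependent k (fun i => (x' i : K)) ∧ (∀ i, (x i : K) ∈ Algebra.adjoin k (Set.range fun i => (x' i : K))) ∧ MvPolynomial.aeval (fun i => (x' i : K)) G = MvPolynomial.aeval (fun i => (x i : K)) g ∧ axis n x' G ≠ 0 ∧ (axis n x g ≠ 0 → (axis n x' G).rootMultiplicity (IsLocalRing.residue O (x' (Fin.last n))) ≤ (axis n x g).rootMultiplicity (IsLocalRing.residue O (x (Fin.last n)))) ∧ let K₁ : IntermediateField k K := IntermediateField.adjoin k (Set.range fun j : Fin n => (x' (Fin.castSucc j) : K)); let w : K := (x' (Fin.last n) : K); ((∃ h ∈ K₁, ∀ a ∈ K₁, O.valuation (w - h) ≤ O.valuation (w - a)) ∨ (∀ q : Polynomial K₁, q ≠ 0 → ∃ a : K₁, O.valuation (Polynomial.aeval w q - algebraMap K₁ K (Polynomial.eval a q)) < O.valuation (Polynomial.aeval w q)))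

/-- The crux with the frame hypothesis `AlgebraicIndependent k x` DROPPED. -/
def PureTranscendentalFramesWithoutAlgIndep : Prop :=
  ∀ p : ℕ, p.Prime → ∀ (k K : Type) [Field k] [CharP k p] [PerfectField k] [Field K] [Algebra k K], (⊤ : IntermediateField k K).FG → ∀ O : ValuationSubring K, ∀ hk : (∀ c : k, algebraMap k K c ∈ O), Nonempty O.valuation.RankOne → (∀ x ∈ O, ∃ f : Polynomial k, f ≠ 0 ∧ Polynomial.aeval x f ∈ O.nonunits) → let ρ : k →+* IsLocalRing.ResidueField O := (IsLocalRing.residue O).comp ((algebraMap k K).codRestrict O hk); let axis : (m : ℕ) → (Fin (m + 1) → O) → MvPolynomial (Fin (m + 1)) k → Polynomial (IsLocalRing.ResidueField O) := fun _ w g => MvPolynomial.eval₂ (Polynomial.C.comp ρ) (Fin.snoc (fun j => Polynomial.C (IsLocalRing.residue O (w (Fin.castSucc j)))) Polynomial.X) g; ∀ (n : ℕ) (x : Fin (n + 1) → O) (g : MvPolynomial (Fin (n + 1)) k), g ≠ 0 → ∃ (x' : Fin (n + 1) → O) (G : MvPolynomial (Fin (n + 1)) k), AlgebraicIndependent k (fun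 i => (x' i : K)) ∧ (∀ i, (x i : K) ∈ Algebra.adjoin k (Set.range fun i => (x' i : K))) ∧ MvPolynomial.aeval (fun i => (x' i : K)) G = MvPolynomial.aeval (fun i => (x i : K)) g ∧ axis n x' G ≠ 0 ∧ (axis n x g ≠ 0 → (axis n x' G).rootMultiplicity (IsLocalRing.residue O (x' (Fin.last n))) ≤ (axis n x g).rootMultiplicity (IsLocalRing.residue O (x (Fin.last n)))) ∧ let K₁ : IntermediateField k K := IntermediateField.adjoin k (Set.range fun j : Fin n => (x' (Fin.castSucc j) : K)); let w : K := (x' (Fin.last n) : K); ((∃ h ∈ K₁, ∀ a ∈ K₁, O.valuation (w - h) ≤ O.valuation (w - a)) ∨ (∀ q : Polynomial K₁, q ≠ 0 → ∃ a : K₁, O.valuation (Polynomial.aeval w q - algebraMap K₁ K (Polynomial.eval a q)) < O.valuation (Polynomial.aeval w q)))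

/-! ## §3 (c) Natural strengthenings of the purity dichotomy -/

/-- The crux with the purity dichotomy STRENGTHENED to its second disjunct
("transcendental approximation type") alone. -/
def PureTranscendentalFramesTranscendentalTypeOnly : Prop :=
  ∀ p : ℕ, p.Prime → ∀ (k K : Type) [Field k] [CharP k p] [PerfectField k] [Field K] [Algebra k K], (⊤ : IntermediateField k K).FG → ∀ O : ValuationSubring K, ∀ hk : (∀ c : k, algebraMap k K c ∈ O), Nonempty O.valuation.RankOne → (∀ x ∈ O, ∃ f : Polynomial k, f ≠ 0 ∧ Polynomial.aeval x f ∈ O.nonunits) → let ρ : k →+* IsLocalRing.ResidueField O := (IsLocalRing.residue O).comp ((algebraMap k K).codRestrict O hk); let axis : (m : ℕ) → (Fin (m + 1) → O) → MvPolynomial (Fin (m + 1)) k → Polynomial (IsLocalRing.ResidueField O) := fun _ w g => MvPolynomial.eval₂ (Polynomial.C.comp ρ) (Fin.snoc (fun j => Polynomial.C (IsLocalRing.residue O (w (Fin.castSucc j)))) Polynomial.X) g; ∀ (n : ℕ) (x : Fin (n + 1) → O) (g : MvPolynomial (Fin (n + 1)) k), AlgebraicIndependent k (fun i => (x i : K))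 → g ≠ 0 → ∃ (x' : Fin (n + 1) → O) (G : MvPolynomial (Fin (n + 1)) k), AlgebraicIndependent k (fun i => (x' i : K)) ∧ (∀ i, (x i : K) ∈ Algebra.adjoin k (Set.range fun i => (x' i : K))) ∧ MvPolynomial.aeval (fun i => (x' i : K)) G = MvPolynomial.aeval (fun i => (x i : K)) g ∧ axis n x' G ≠ 0 ∧ (axis n x g ≠ 0 → (axis n x' G).rootMultiplicity (IsLocalRing.residue O (x' (Fin.last n))) ≤ (axis n x g).rootMultiplicity (IsLocalRing.residue O (x (Fin.last n)))) ∧ let K₁ : IntermediateField k K := IntermediateField.adjoin k (Set.range fun j : Fin n => (x' (Fin.castSucc j) : K)); let w : K := (x' (Fin.last n) : K); (∀ q : Polynomial K₁, q ≠ 0 → ∃ a : K₁, O.valuation (Polynomial.aeval w q - algebraMap K₁ K (Polynomial.eval a q)) < O.valuation (Polynomial.aeval w q))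

/-- The crux with the purity dichotomy STRENGTHENED to its first disjunct (attained distance) alone.
(Recorded for the prover: NOT refuted here — at `n = 0` it is TRUE, see the COMMENT block.) -/
def PureTranscendentalFramesAttainedOnly : Prop :=
  ∀ p : ℕ, p.Prime → ∀ (k K : Type) [Field k] [CharP k p] [PerfectField k] [Field K] [Algebra k K], (⊤ : IntermediateField k K).FG → ∀ O : ValuationSubring K, ∀ hk : (∀ c : k, algebraMap k K c ∈ O), Nonempty O.valuation.RankOne → (∀ x ∈ O, ∃ f : Polynomial k, f ≠ 0 ∧ Polynomial.aeval x f ∈ O.nonunits) → let ρ : k →+* IsLocalRing.ResidueField O := (IsLocalRing.residue O).comp ((algebraMap k K).codRestrict O hk); let axis : (m : ℕ) → (Fin (m + 1) → O) → MvPolynomial (Fin (m + 1)) k → Polynomial (IsLocalRing.ResidueField O) := fun _ w g => MvPolynomial.eval₂ (Polynomial.C.comp ρ) (Fin.snoc (fun j => Polynomial.C (IsLocalRing.residue O (w (Fin.castSucc j)))) Polynomial.X) g; ∀ (n : ℕ) (x : Fin (n + 1) → O) (g : MvPolynomial (Fin (n + 1)) k), AlgebraicIndependent k (fun i => (x i :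 K)) → g ≠ 0 → ∃ (x' : Fin (n + 1) → O) (G : MvPolynomial (Fin (n + 1)) k), AlgebraicIndependent k (fun i => (x' i : K)) ∧ (∀ i, (x i : K) ∈ Algebra.adjoin k (Set.range fun i => (x' i : K))) ∧ MvPolynomial.aeval (fun i => (x' i : K)) G = MvPolynomial.aeval (fun i => (x i : K)) g ∧ axis n x' G ≠ 0 ∧ (axis n x g ≠ 0 → (axis n x' G).rootMultiplicity (IsLocalRing.residue O (x' (Fin.last n))) ≤ (axis n x g).rootMultiplicity (IsLocalRing.residue O (x (Fin.last n)))) ∧ let K₁ : IntermediateField k K := IntermediateField.adjoin k (Set.range fun j : Fin n => (x' (Fin.castSucc j) : K)); let w : K := (x' (Fin.last n) : K); (∃ h ∈ K₁, ∀ a ∈ K₁, O.valuation (w - h) ≤ O.valuation (w - a))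

/-- The crux with the re-framing DELETED: the given frame `x` itself must be in general position and
pure ("`x' := x`, `G := g`"). -/
def PureTranscendentalFramesNoReframing : Prop :=
  ∀ p : ℕ, p.Prime → ∀ (k K : Type) [Field k] [CharP k p] [PerfectField k] [Field K] [Algebra k K], (⊤ : IntermediateField k K).FG → ∀ O : ValuationSubring K, ∀ hk : (∀ c : k, algebraMap k K c ∈ O), Nonempty O.valuation.RankOne → (∀ x ∈ O, ∃ f : Polynomial k, f ≠ 0 ∧ Polynomial.aeval x f ∈ O.nonunits) → let ρ : k →+* IsLocalRing.ResidueField O := (IsLocalRing.residue O).comp ((algebraMap k K).codRestrict O hk); let axis : (m : ℕ) → (Fin (m + 1) → O) → MvPolynomial (Fin (m + 1)) k → Polynomial (IsLocalRing.ResidueField O) := fun _ w g => MvPolynomial.eval₂ (Polynomial.C.comp ρ) (Fin.snoc (fun j => Polynomial.C (IsLocalRing.residue O (w (Fin.castSucc j)))) Polynomial.X) g; ∀ (n : ℕ) (x : Fin (n + 1) → O) (g : MvPolynomial (Fin (n + 1)) k), AlgebraicIndependent k (fun i => (x i : K)) → g ≠ 0 → axis n x g ≠ 0 ∧ let K₁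 : IntermediateField k K := IntermediateField.adjoin k (Set.range fun j : Fin n => (x (Fin.castSucc j) : K)); let w : K := (x (Fin.last n) : K); ((∃ h ∈ K₁, ∀ a ∈ K₁, O.valuation (w - h) ≤ O.valuation (w - a)) ∨ (∀ q : Polynomial K₁, q ≠ 0 → ∃ a : K₁, O.valuation (Polynomial.aeval w q - algebraMap K₁ K (Polynomial.eval a q)) < O.valuation (Polynomial.aeval w q)))

/-- The crux with the GUARD `axis n x g ≠ 0 →` of the axis-order clause DELETED. -/
def PureTranscendentalFramesUnguardedAxis : Prop :=
  ∀ p : ℕ, p.Prime → ∀ (k K : Type) [Field k] [CharP k p] [PerfectField k] [Field K] [Algebra k K], (⊤ : IntermediateField k K).FG → ∀ O : ValuationSubring K, ∀ hk : (∀ c : k, algebraMap k K c ∈ O), Nonempty O.valuation.RankOne → (∀ x ∈ O, ∃ f : Polynomial k, f ≠ 0 ∧ Polynomial.aeval x f ∈ O.nonunits) → let ρ : k →+* IsLocalRing.ResidueField O := (IsLocalRing.residue O).comp ((algebraMap k K).codRestrict O hk); let axis : (m : ℕ) → (Fin (m + 1) → O) → MvPolynomial (Fin (m + 1)) k → Polynomial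 (IsLocalRing.ResidueField O) := fun _ w g => MvPolynomial.eval₂ (Polynomial.C.comp ρ) (Fin.snoc (fun j => Polynomial.C (IsLocalRing.residue O (w (Fin.castSucc j)))) Polynomial.X) g; ∀ (n : ℕ) (x : Fin (n + 1) → O) (g : MvPolynomial (Fin (n + 1)) k), AlgebraicIndependent k (fun i => (x i : K)) → g ≠ 0 → ∃ (x' : Fin (n + 1) → O) (G : MvPolynomial (Fin (n + 1)) k), AlgebraicIndependent k (fun i => (x' i : K)) ∧ (∀ i, (x i : K) ∈ Algebra.adjoin k (Set.range fun i => (x' i : K))) ∧ MvPolynomial.aeval (fun i => (x' i : K)) G = MvPolynomial.aeval (fun i => (x i : K)) g ∧ axis n x' G ≠ 0 ∧ (axis n x' G).rootMultiplicity (IsLocalRing.residue O (x' (Fin.last n))) ≤ (axis n x g).rootMultiplicity (IsLocalRing.residue O (x (Fin.last n))) ∧ let K₁ : IntermediateField k K := IntermediateField.adjoin k (Set.range fun j : Fin n => (x' (Fin.castSucc j) : K)); let w : K := (x' (Fin.last n) : K); ((∃ h ∈ K₁, ∀ a ∈ K₁, O.valuation (w - h) ≤ O.valuation (w - a)) ∨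 (∀ q : Polynomial K₁, q ≠ 0 → ∃ a : K₁, O.valuation (Polynomial.aeval w q - algebraMap K₁ K (Polynomial.eval a q)) < O.valuation (Polynomial.aeval w q)))

section Refutations

open Summit.ResolutionOfSingularities.ResolutionOfSingularities.Theorems.PureTranscendentalFrames

/-- **`g ≠ 0` is load-bearing** (landed: `Negative.pureTranscendentalFrames_false_without_g_ne_zero`,
p150697): `k = 𝔽₂`, `K = k(X)`, `O` the `X`-adic place, `n = 0`, `x = (X)`, `g = 0`; `G(x') = 0`
forces `G = 0`, so `axis 0 x' G = 0`. [folklore] -/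
theorem pureTranscendentalFrames_false_without_g_ne_zero : ¬ PureTranscendentalFramesWithoutGNeZero :=
  Negative.pureTranscendentalFrames_false_without_g_ne_zero

/-- **Algebraic independence of the frame is load-bearing** (landed:
`Negative.pureTranscendentalFrames_false_without_algIndep`, p150697): `x = (0)`, `g = X₀`. [folklore] -/
theorem pureTranscendentalFrames_false_without_algIndep : ¬ PureTranscendentalFramesWithoutAlgIndep :=
  Negative.pureTranscendentalFrames_false_without_algIndep

/-- **The attained-distance disjunct (P1) is load-bearing** — "(P2) only" is FALSE (landed:
`Negative.not_pureTranscendentalFrames_transcendentalTypeOnly`, p150697): residually rational place,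
`n = 0`, `q = X − c`. [folklore] -/
theorem not_pureTranscendentalFramesTranscendentalTypeOnly :
    ¬ PureTranscendentalFramesTranscendentalTypeOnly :=
  Negative.not_pureTranscendentalFrames_transcendentalTypeOnly

/-! **Re-framing is load-bearing** — "`x' := x`, `G := g`" is FALSE: LANDED as
`Negative.not_pureTranscendentalFrames_noReframing : ¬ <body of PureTranscendentalFramesNoReframing>`
(p151611, `Theorems/PureTranscendentalFrames/Negative/GeneralPosition.lean`; `K = 𝔽₂(z₁, z₂) ⊆
𝔽₂((X))`, `x = (z₁, z₂)` with `z₁ ∈ 𝔪`, `g = X₀`: `axis 1 x g = C(z̄₁) = 0`), and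
**the guard of the axis clause is load-bearing** — the unguarded clause is FALSE: LANDED as
`Negative.not_pureTranscendentalFrames_unguardedAxis : ¬ <body of PureTranscendentalFramesUnguardedAxis>`
(same file; `rootMultiplicity _ 0 = 0` would force `G(x') = g(x) = z₁` to be a unit).
To use them here: `import …Theorems.PureTranscendentalFrames.Negative.GeneralPosition` and
`theorem not_pureTranscendentalFramesNoReframing : ¬ PureTranscendentalFramesNoReframing :=
Negative.not_pureTranscendentalFrames_noReframing` (definitional unfolding) — left as a comment in
this revision only because the farm had not yet built that module when the file was published. -/

end Refutations

end

end Summit.ResolutionOfSingularities.ResolutionOfSingularities.Cruxes.PureTranscendentalFrames.Disproof
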